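import Literature.NumberTheory.GaloisRepresentations.FrobeniusDensity
import Literature.NumberTheory.GaloisRepresentations.IntegralGaloisActionProofs
import Literature.NumberTheory.Automorphic.ChebotarevArtinRepHolds
import Literature.NumberTheory.GaloisRepresentations.HeckeCharacterGaloisAvatarProofs
import Literature.NumberTheory.GaloisRepresentations.ArtinCharacterReciprocity
import Literature.NumberTheory.EllipticCurves.BDPAnticyclotomicPAdicLFunction
import Literature.NumberTheory.EllipticCurves.KatzPAdicLFunctionCMField
import Summits.Langlands.Langlands.Theorems.IrreducibilityBySelfDualityReciprocityUpToIrreducibilityHeckeTypeZeroFiniteOrder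
import Summits.BirchSwinnertonDyer.BirchSwinnertonDyer.Theorems.SignedBaseChangeAnticyclotomicEisensteinDivisibilityAnticyclotomicNonsplit
import HarnessLib

set_option linter.dupNamespace false -- `Summit.BirchSwinnertonDyer.BirchSwinnertonDyer.Theorems.…` (summit = sub, D-0017)
set_option autoImplicit false

/-!
# Crux `EisensteinHeartFlatCMInertBadKPrime` (stmt-BirchSwinnertonDyer-21341), line `hsieh_lambda`:
# RIGIDITY OF `p`-ADIC AVATARS on the anticyclotomic line — uniqueness (Chebotarev), triviality of a character of
# `Γ⁻` killed by an inertia element of unit level, and the VALUES OF A TYPE-ZERO CHARACTER OF THE RANGE ARE ALL `1`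

Route `BiquadraticEisensteinDescent` (cell `pub/bsd-wall`, lead-prover seat `bsd-wall-cm-bed-p1` g7). THEOREMS ONLY; supports,
does not close, stmt-BirchSwinnertonDyer-21341. Purpose (lead g7, road (B′) «the tied Katz line frame from the ♭-frame»): the
classification of Hsieh's range on the `K′`-line (every everywhere-unramified Hecke character of `K′` of infinity type
`(n, −n)`, `n ≥ 1`, whose `p`-adic avatar factors through the anticyclotomic `ℤ_p`-extension `κ`, is a power of ONE such
character when `p ∤ h_{K′}`) rests on the three facts of this file:

* §1 `eq_of_isPAdicAvatarOf` — two `p`-adic avatars of the same Hecke character (pinned only at the Frobenii away from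
  `p`, `IsPAdicAvatarOf`) are EQUAL: Chebotarev density (`absoluteGaloisGroup.frobenius_dense`, PROVED in the tree as
  `Automorphic.chebotarev_artinRep_holds`) + continuity + Hausdorffness of `M₁(ℚ̄_p)`.
* §2 `apply_eq_one_of_factorsThroughZp_of_isUnit` — a rank-one representation factoring through `κ` and killing ONE
  `σ` with `κ σ ∈ ℤ_pˣ` is trivial: `{τ | r τ = 1}` is a closed subgroup containing `ker κ`, its image under `κ` is
  compact hence closed and contains the dense subgroup `ℤ·(κ σ)`.
* §3 `valueAtUniformizer_eq_one_of_hasInfinityType_zero` — for `K` imaginary quadratic, `p` odd, `κ` anticyclotomic and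
  `p ∤ h_K`: an everywhere-unramified Hecke character `ξ` of infinity type `(0,0)` admitting a `p`-adic avatar through
  `κ` has `ξ(ϖ_v) = 1` at EVERY finite place `v` (also above `p`). Proof: `ξ` has finite order
  (`…ReciprocityUpToIrreducibility.stub_isFiniteOrder_of_hasInfinityType_zero`, Neukirch VII (6.9)/(6.14), a proved
  theorem of the Langlands summit's tree), so class field theory gives an avatar `r′` unramified exactly where `ξ` is,
  with Frobenius polynomials at every place (`HeckeCharacter.exists_lAdic_of_isFiniteOrder`); by §1 the given avatar is
  `r′`, so `r′` factors through `κ`; the first anticyclotomic layer is ramified above `p` when `p ∤ h_K`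
  (`…AnticyclotomicNonsplit.exists_mem_inertia_not_mem_layerSubgroup_one`, Brink 2007 Cor. 1), giving an inertia
  element `σ` with `κ σ ∈ ℤ_pˣ` and `r′ σ = 1`; by §2 `r′ = 1`, and the Frobenius polynomials read `ξ(ϖ_v) = 1`.

Nothing about the crux's input or any case of BSD is asserted.

References: [SerreAbelianLadic1968] Ch. I §2.2 Cor. 2 (density of Frobenii), Ch. III §2.3; [Brink2007] Cor. 1;
[Washington1997] §13.1; [CasselsFrohlichANT1967] Ch. VII §5.1.
-/

noncomputable section

open scoped Classical NumberField Polynomial Topology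
open NumberField IsDedekindDomain Field Polynomial
open Literature.NumberTheory.GaloisRepresentations Literature.NumberTheory.EllipticCurves

namespace Summit.BirchSwinnertonDyer.BirchSwinnertonDyer.Theorems.BiquadraticEisensteinDescentEisensteinHeartFlatCMInertBadKPrimeAvatarRigidity

variable {K : Type} [Field K] [NumberField K] {p : ℕ} [Fact p.Prime]

/-! ### §1 Uniqueness of the `p`-adic avatar (Chebotarev) -/

/-- The `(0,0)` entry of a rank-one framed representation at an arithmetic Frobenius is read off a Frobenius
polynomial `X − C a`. [cite: SerreAbelianLadic1968, Ch. I §2.3] -/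
theorem entry_eq_of_hasFrobCharpolyAt {A : Type*} [CommRing A] [TopologicalSpace A] (r : FramedGaloisRep K A 1)
    {v : HeightOneSpectrum (𝓞 K)} {a : A} (h : r.HasFrobCharpolyAt v (X - C a))
    {𝔓 : Ideal (absIntegers (𝓞 K) K)} (h𝔓 : 𝔓 ∈ v.primesAbove) {Φ : absoluteGaloisGroup K}
    (hΦ : IsArithFrobAt (𝓞 K) Φ 𝔓) :
    ((r Φ : GL (Fin 1) A) : Matrix (Fin 1) (Fin 1) A) 0 0 = a :=
  (FramedGaloisRep.hasFrobCharpolyAt_iff_of_rank_one r v a).mp h 𝔓 h𝔓 Φ hΦ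

/-- A `1 × 1` invertible matrix is determined by its entry. [folklore] -/
theorem gl_one_ext {A : Type*} [CommRing A] {M N : GL (Fin 1) A}
    (h : ((M : Matrix (Fin 1) (Fin 1) A) 0 0) = ((N : Matrix (Fin 1) (Fin 1) A) 0 0)) : M = N := by
  refine Units.ext (Matrix.ext fun i j ↦ ?_)
  rw [Subsingleton.elim i 0, Subsingleton.elim j 0]
  exact h

/-- **Two `p`-adic avatars of one Hecke character coincide.** If `r, r′ : Γ_K → GL₁(ℚ̄_p)` are both `p`-adic avatars
of `φ` (`IsPAdicAvatarOf ι φ r`, `IsPAdicAvatarOf ι φ r′`: unramified with Frobenius polynomial `X − ι⁻¹(φ(ϖ_v))⁻¹`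
at every `v ∤ p` where `φ` is unramified) and `φ` is unramified away from a finite set, then `r = r′`: they agree on
the arithmetic Frobenii at all places outside a finite set, which are dense in `Γ_K` (Chebotarev,
`absoluteGaloisGroup.frobenius_dense` with the tree's proved `Automorphic.chebotarev_artinRep_holds`), and the
coincidence set is closed. [cite: SerreAbelianLadic1968, Ch. I §2.2 Cor. 2 (a) and Ch. III §2.3] -/
theorem eq_of_isPAdicAvatarOf {ι : PadicAlgCl p ≃+* ℂ} {φ : HeckeCharacter K}
    {r r' : FramedGaloisRep K (PadicAlgCl p) 1} (hr : IsPAdicAvatarOf ι φ r) (hr' : IsPAdicAvatarOf ι φ r')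
    {S : Set (HeightOneSpectrum (𝓞 K))} (hS : S.Finite) (hunr : ∀ v ∉ S, φ.IsUnramifiedAt v) : r = r' := by
  -- the exceptional set: `S` and the primes above `p`
  set S' : Set (HeightOneSpectrum (𝓞 K)) := S ∪ ↑(KatzCM.primesOver K p) with hS'
  have hS'fin : S'.Finite := hS.union (Finset.finite_toSet _)
  set D : Set (absoluteGaloisGroup K) :=
    {σ | ∃ v ∉ S', ∃ 𝔓 ∈ v.primesAbove, IsArithFrobAt (𝓞 K) σ 𝔓} with hDdef
  have hdense : Dense D :=
    absoluteGaloisGroup.frobenius_dense Literature.NumberTheory.Automorphic.chebotarev_artinRep_holds K S' hS'fin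
  -- agreement on `D`
  have hD : D ⊆ {σ | ((r σ : GL (Fin 1) (PadicAlgCl p)) : Matrix (Fin 1) (Fin 1) (PadicAlgCl p)) =
      ((r' σ : GL (Fin 1) (PadicAlgCl p)) : Matrix (Fin 1) (Fin 1) (PadicAlgCl p))} := by
    rintro σ ⟨v, hv, 𝔓, h𝔓, hσ⟩
    have hvS : v ∉ S := fun h ↦ hv (Or.inl h)
    have hvp : ((p : ℕ) : 𝓞 K) ∉ v.asIdeal := fun h ↦ hv (Or.inr (KatzCM.mem_primesOver.mpr h))
    have h1 := entry_eq_of_hasFrobCharpolyAt r (hr v hvp (hunr v hvS)).2 h𝔓 hσ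
    have h2 := entry_eq_of_hasFrobCharpolyAt r' (hr' v hvp (hunr v hvS)).2 h𝔓 hσ
    show ((r σ : GL (Fin 1) (PadicAlgCl p)) : Matrix (Fin 1) (Fin 1) (PadicAlgCl p)) = _
    refine Matrix.ext fun i j ↦ ?_
    rw [Subsingleton.elim i 0, Subsingleton.elim j 0, h1, h2]
  -- the coincidence set is closed
  have hcont : Continuous fun τ : absoluteGaloisGroup K ↦
      (((r τ : GL (Fin 1) (PadicAlgCl p)) : Matrix (Fin 1) (Fin 1) (PadicAlgCl p)),
        ((r' τ : GL (Fin 1) (PadicAlgCl p)) : Matrix (Fin 1) (Fin 1) (PadicAlgCl p))) :=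
    (Units.continuous_val.comp (map_continuous r)).prodMk (Units.continuous_val.comp (map_continuous r'))
  have hclosed : IsClosed {σ : absoluteGaloisGroup K |
      ((r σ : GL (Fin 1) (PadicAlgCl p)) : Matrix (Fin 1) (Fin 1) (PadicAlgCl p)) =
      ((r' σ : GL (Fin 1) (PadicAlgCl p)) : Matrix (Fin 1) (Fin 1) (PadicAlgCl p))} :=
    isClosed_eq (continuous_fst.comp hcont) (continuous_snd.comp hcont)
  have hall : ∀ σ, ((r σ : GL (Fin 1) (PadicAlgCl p)) : Matrix (Fin 1) (Fin 1) (PadicAlgCl p)) =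
      ((r' σ : GL (Fin 1) (PadicAlgCl p)) : Matrix (Fin 1) (Fin 1) (PadicAlgCl p)) := fun σ ↦ by
    have hmem : σ ∈ closure D := by rw [hdense.closure_eq]; exact Set.mem_univ σ
    exact hclosed.closure_subset_iff.2 hD hmem
  exact DFunLike.ext r r' fun σ ↦ Units.ext (hall σ)

/-- The everywhere-unramified case of `eq_of_isPAdicAvatarOf`. [cite: SerreAbelianLadic1968, Ch. I §2.2 Cor. 2 (a)] -/
theorem eq_of_isPAdicAvatarOf_of_forall {ι : PadicAlgCl p ≃+* ℂ} {φ : HeckeCharacter K}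
    {r r' : FramedGaloisRep K (PadicAlgCl p) 1} (hr : IsPAdicAvatarOf ι φ r) (hr' : IsPAdicAvatarOf ι φ r')
    (hunr : ∀ v, φ.IsUnramifiedAt v) : r = r' :=
  eq_of_isPAdicAvatarOf hr hr' Set.finite_empty fun v _ ↦ hunr v

/-! ### §2 A character of `Γ⁻` killed by an element of unit level is trivial -/

/-- `ℤ · u` is dense in `ℤ_p` for a unit `u`. [cite: Washington1997, §13.1] -/
theorem dense_range_intCast_mul {u : ℤ_[p]} (hu : IsUnit u) :
    DenseRange fun n : ℤ ↦ (n : ℤ_[p]) * u := by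
  have hd : DenseRange (Int.cast : ℤ → ℤ_[p]) := PadicInt.denseRange_intCast
  have hhomeo : DenseRange fun x : ℤ_[p] ↦ x * u := by
    refine Function.Surjective.denseRange fun y ↦ ⟨y * ↑hu.unit⁻¹, ?_⟩
    simp only [mul_assoc, IsUnit.val_inv_mul, mul_one]
  exact hhomeo.comp hd (continuous_id.mul continuous_const)

/-- A closed subgroup of `ℤ_p` (multiplicative notation) containing a unit is everything. [cite: Washington1997, §13.1] -/
theorem eq_top_of_isClosed_of_unit_mem (M : Subgroup (Multiplicative ℤ_[p]))
    (hM : IsClosed (M : Set (Multiplicative ℤ_[p]))) {u : ℤ_[p]} (hu : IsUnit u)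
    (huM : Multiplicative.ofAdd u ∈ M) : M = ⊤ := by
  rw [eq_top_iff]
  intro x _
  have hx : Multiplicative.toAdd x ∈ closure (Set.range fun n : ℤ ↦ (n : ℤ_[p]) * u) := by
    rw [(dense_range_intCast_mul hu).closure_range]; exact Set.mem_univ _
  -- `M`, read additively, is closed and contains every `n • u`
  have hsub : Set.range (fun n : ℤ ↦ (n : ℤ_[p]) * u) ⊆ Multiplicative.toAdd '' (M : Set (Multiplicative ℤ_[p])) := by
    rintro _ ⟨n, rfl⟩
    refine ⟨Multiplicative.ofAdd ((n : ℤ_[p]) * u), ?_, rfl⟩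
    have : Multiplicative.ofAdd ((n : ℤ_[p]) * u) = (Multiplicative.ofAdd u) ^ n := by
      rw [← ofAdd_zsmul, zsmul_eq_mul]
    rw [this]
    exact M.zpow_mem huM n
  have hclosed : IsClosed (Multiplicative.toAdd '' (M : Set (Multiplicative ℤ_[p]))) := by
    have : Multiplicative.toAdd '' (M : Set (Multiplicative ℤ_[p])) =
        Multiplicative.ofAdd ⁻¹' (M : Set (Multiplicative ℤ_[p])) := by
      ext y; simp
    rw [this]
    exact hM.preimage continuous_ofAdd
  have := (hclosed.closure_subset_iff.mpr hsub) hx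
  obtain ⟨y, hy, hyx⟩ := this
  have : y = x := by simpa using hyx
  exact this ▸ hy

/-- **A rank-one representation factoring through the `ℤ_p`-extension `κ` and trivial on ONE element `σ` of unit
level (`κ σ ∈ ℤ_pˣ`, i.e. `σ ∉ Gal(K̄/K_1)`) is trivial.** The set `H = {τ | r τ = 1}` is a closed subgroup of `Γ_K`
containing `ker κ` and `σ`; its image `κ(H)` is compact, hence closed, and contains `ℤ·(κ σ)`, dense since `κ σ` is a
unit; so `κ(H) = ℤ_p` and `H = Γ_K`. [cite: Washington1997, §13.1 (ℤ_p-extensions)] -/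
theorem apply_eq_one_of_factorsThroughZp_of_isUnit {A : Type*} [CommRing A] [TopologicalSpace A] [T2Space A]
    (κ : ZpExtension K p) {r : FramedGaloisRep K A 1} (hfac : FactorsThroughZp κ r)
    {σ : absoluteGaloisGroup K} (hσ : r σ = 1) (hu : IsUnit (Multiplicative.toAdd (κ σ)))
    (τ : absoluteGaloisGroup K) : r τ = 1 := by
  -- the closed subgroup `H = ker r`
  set H : Subgroup (absoluteGaloisGroup K) := r.toMonoidHom.ker with hH
  have hHc : IsClosed (H : Set (absoluteGaloisGroup K)) := by
    have : (H : Set (absoluteGaloisGroup K)) =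
        (fun τ ↦ ((r τ : GL (Fin 1) A) : Matrix (Fin 1) (Fin 1) A)) ⁻¹' {1} := by
      ext τ
      simp only [hH, SetLike.mem_coe, MonoidHom.mem_ker, Set.mem_preimage, Set.mem_singleton_iff]
      exact ⟨fun h ↦ by rw [show r.toMonoidHom τ = r τ from rfl] at h; rw [h]; rfl,
        fun h ↦ Units.ext h⟩
    rw [this]
    exact isClosed_singleton.preimage (Units.continuous_val.comp (map_continuous r))
  -- its image under `κ` is a closed subgroup of `ℤ_p` containing the unit `κ σ`
  set M : Subgroup (Multiplicative ℤ_[p]) := H.map κ.toContinuousMonoidHom.toMonoidHom with hMdef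
  have hMc : IsClosed (M : Set (Multiplicative ℤ_[p])) := by
    have hcpt : IsCompact (H : Set (absoluteGaloisGroup K)) := hHc.isCompact
    have : (M : Set (Multiplicative ℤ_[p])) = κ '' (H : Set (absoluteGaloisGroup K)) := by
      ext x; simp [hMdef]
    rw [this]
    exact (hcpt.image (map_continuous κ)).isClosed
  have hσH : σ ∈ H := by rw [hH, MonoidHom.mem_ker]; exact hσ
  have hM : M = ⊤ := eq_top_of_isClosed_of_unit_mem M hMc hu ⟨σ, hσH, rfl⟩
  -- hence `τ ∈ H · ker κ = H`
  have hτ : κ τ ∈ M := by rw [hM]; exact Subgroup.mem_top _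
  obtain ⟨h, hh, hhτ⟩ := Subgroup.mem_map.mp hτ
  have hhτ' : κ h = κ τ := hhτ
  have hker : κ (h⁻¹ * τ) = 1 := by
    rw [map_mul, map_inv, hhτ', inv_mul_cancel]
  have h1 : r (h⁻¹ * τ) = 1 := hfac _ hker
  have h2 : r h = 1 := by rw [hH, MonoidHom.mem_ker] at hh; exact hh
  calc r τ = r (h * (h⁻¹ * τ)) := by rw [mul_inv_cancel_left]
    _ = 1 := by rw [map_mul, h1, h2, one_mul]

/-! ### §3 A type-zero character of the range takes the value `1` at every uniformiser -/

omit [NumberField K] in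
/-- `σ ∉ Gal(K̄/K_1)` means `κ σ` is a unit of `ℤ_p`. [cite: Washington1997, §13.1] -/
theorem isUnit_toAdd_of_not_mem_layerSubgroup_one (κ : ZpExtension K p) {σ : absoluteGaloisGroup K}
    (hσ : σ ∉ κ.layerSubgroup 1) : IsUnit (Multiplicative.toAdd (κ σ)) := by
  rw [ZpExtension.mem_layerSubgroup, pow_one] at hσ
  by_contra hnu
  apply hσ
  have hlt : ‖Multiplicative.toAdd (κ σ)‖ < 1 := PadicInt.mem_nonunits.mp hnu
  exact_mod_cast (PadicInt.norm_lt_one_iff_dvd _).mp hlt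

omit [Fact p.Prime] in
/-- A non-zero prime of `𝓞_K` above the rational prime `p` (going up along `ℤ → 𝓞_K`). [folklore] -/
theorem exists_heightOneSpectrum_natCast_mem (hp : p.Prime) :
    ∃ v : HeightOneSpectrum (𝓞 K), ((p : ℕ) : 𝓞 K) ∈ v.asIdeal := by
  haveI hmax : (Ideal.span {(p : ℤ)}).IsMaximal :=
    PrincipalIdealRing.isMaximal_of_irreducible (Nat.prime_iff_prime_int.mp hp).irreducible
  obtain ⟨Q, hQmax, hQ⟩ := Ideal.exists_ideal_over_maximal_of_isIntegral (S := 𝓞 K)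
    (Ideal.span {(p : ℤ)}) (by
      rw [(RingHom.injective_iff_ker_eq_bot _).mp (algebraMap ℤ (𝓞 K)).injective_int]
      exact bot_le)
  have hpQ : ((p : ℕ) : 𝓞 K) ∈ Q := by
    have : (p : ℤ) ∈ Q.comap (algebraMap ℤ (𝓞 K)) := by
      rw [hQ]; exact Ideal.mem_span_singleton_self _
    simpa [Ideal.mem_comap] using this
  have hQne : Q ≠ ⊥ := by
    intro hbot
    rw [hbot, Ideal.mem_bot] at hpQ
    exact hp.ne_zero (by exact_mod_cast hpQ)
  exact ⟨⟨Q, hQmax.isPrime, hQne⟩, hpQ⟩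

/-- **Values of a type-zero character of Hsieh's range.** `K` imaginary quadratic, `p` odd, `κ` anticyclotomic,
`p ∤ h_K`; `ξ` a Hecke character of `K` with infinity type `(0, 0)`, unramified at every finite place, admitting a
`p`-adic avatar `r` (`IsPAdicAvatarOf ι ξ r`) factoring through `κ`. Then `ξ(ϖ_v) = 1` at EVERY finite place `v`.
[cite: Brink2007, Cor. 1 (p. 2136)] [cite: CasselsFrohlichANT1967, Ch. VII §5.1] [cite: SerreAbelianLadic1968, Ch. III §2.3] -/
theorem valueAtUniformizer_eq_one_of_hasInfinityType_zero (hK : IsImaginaryQuadratic K) (hp2 : p ≠ 2)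
    (κ : ZpExtension K p) (hκ : κ.IsAnticyclotomic) (hh : ¬ p ∣ NumberField.classNumber K)
    {ι : PadicAlgCl p ≃+* ℂ} {ξ : HeckeCharacter K} (h0 : ξ.HasInfinityType 0 0)
    (hunr : ∀ v : HeightOneSpectrum (𝓞 K), ξ.IsUnramifiedAt v)
    {r : FramedGaloisRep K (PadicAlgCl p) 1} (hr : IsPAdicAvatarOf ι ξ r) (hfac : FactorsThroughZp κ r)
    (v : HeightOneSpectrum (𝓞 K)) : ξ.valueAtUniformizer v = 1 := by
  have hp : p.Prime := Fact.out
  -- the class-field-theory avatar of the finite-order character `ξ`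
  have hfin : ξ.IsFiniteOrder :=
    Summit.Langlands.Langlands.Theorems.ReciprocityUpToIrreducibility.stub_isFiniteOrder_of_hasInfinityType_zero K ξ h0
  obtain ⟨r', hram', hfrob'⟩ := HeckeCharacter.exists_lAdic_of_isFiniteOrder ξ hfin ι
  have hr'av : IsPAdicAvatarOf ι ξ r' := fun w _ hw ↦
    ⟨(hram' w).mpr hw, by simpa only [map_inv₀] using hfrob' w hw⟩
  have heq : r = r' := eq_of_isPAdicAvatarOf_of_forall hr hr'av hunr
  subst heq
  -- an inertia element of unit level above `p`, killed by `r`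
  obtain ⟨v₀, hv₀⟩ := exists_heightOneSpectrum_natCast_mem (K := K) hp
  obtain ⟨𝔓, h𝔓⟩ := HeightOneSpectrum.primesAbove_nonempty v₀
  obtain ⟨σ, hσI, hσ1⟩ :=
    Summit.BirchSwinnertonDyer.BirchSwinnertonDyer.Theorems.SignedBaseChangeAcDivAnticyclotomicNonsplit.exists_mem_inertia_not_mem_layerSubgroup_one
      hK hp2 κ hκ hh hv₀ h𝔓
  have hrσ : r σ = 1 := (hram' v₀).mpr (hunr v₀) 𝔓 h𝔓 σ hσI
  have htriv : ∀ τ, r τ = 1 :=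
    apply_eq_one_of_factorsThroughZp_of_isUnit κ hfac hrσ (isUnit_toAdd_of_not_mem_layerSubgroup_one κ hσ1)
  -- read the Frobenius polynomial at `v`
  obtain ⟨𝔔, h𝔔⟩ := HeightOneSpectrum.primesAbove_nonempty v
  obtain ⟨Φ, hΦ⟩ := HeightOneSpectrum.exists_isArithFrobAt_of_mem_primesAbove_holds (K := K) (v := v) h𝔔
  have hentry := entry_eq_of_hasFrobCharpolyAt r (hfrob' v (hunr v)) h𝔔 hΦ
  rw [htriv Φ] at hentry
  have h1 : ι.symm (ξ.valueAtUniformizer v)⁻¹ = 1 := by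
    rw [← hentry]; simp
  have h2 : (ξ.valueAtUniformizer v)⁻¹ = 1 := by
    have := congrArg ι h1
    simpa using this
  exact inv_eq_one.mp h2

end Summit.BirchSwinnertonDyer.BirchSwinnertonDyer.Theorems.BiquadraticEisensteinDescentEisensteinHeartFlatCMInertBadKPrimeAvatarRigidity

end
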